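import Summits.BirchSwinnertonDyer.BirchSwinnertonDyer.Theorems.KatoDescentPotSupersingularReducibleZetaDivisibilityOfMember
import Summits.BirchSwinnertonDyer.BirchSwinnertonDyer.Theorems.KatoDescentPotSupersingularTowerTorsionVanishing
import Literature.NumberTheory.EllipticCurves.Kato2004.IwasawaH2FineSelmerDualComparison
import Literature.NumberTheory.EllipticCurves.IwasawaAlgebraProofs
import HarnessLib

/-!
# Kato Thm. 12.5 (3)–(4) / Wuthrich L.14 for Kato's (14.14.1)-PINNED `𝐇²_Γ(T_pW)` on the REDUCIBLE non-CM rank-`0` rows, from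
# ATOMIC named facts: a descent package `J : IwasawaH2Data` with `X₀(W/ℚ_∞) ↪ J.H2` (finite cokernel), `μ(J.H2) = 0`, and
# `char_Λ(𝐇¹_Γ/Λ𝐲) ⊆ char_Λ(J.H2)` for Kato's own zeta class `𝐲` — the `H2`-block of the held core package 27962
# (`finite_H2`, `isTorsion_H2`, the `A`-pin, `ι`, `π`, (14.14.1), `mu_H2`, `divisibility_offP` in its `𝐲`-form) realised by
# ONE `J` (route-free helper for crux M = stmt-BirchSwinnertonDyer-19196, K9 / K8-t′)

Seat `bsd-potss-rkm` g26 (prover, cell `bsd-potss`), `--supports stmt-BirchSwinnertonDyer-19196 --as helper`; closes nothing.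
HONEST FRAMING: BSD is not proved by any of this; nothing is booked; crux M stays settled-by-citation over the HELD package
`Kato2004.exists_memberHullZetaCoreInputs` (27962); theorems only (no definition, no named fact, no `sorry`).

## What, and why now

Crux M's held input `exists_memberHullZetaCoreInputs` packages, next to the hull / zeta-line data, an ABSTRACT `H2` ("Kato's
`𝐇²(T)⁰`") carrying (12.2.1), Thm. 12.4 (1), the pinned descent sequence (14.14.1), `μ(𝐇²) = 0` (Wuthrich L.14) and the
divisibility `ℓ_𝔮(𝐇²) ≤ ℓ_𝔮(F/Λz_γ)` off `(p)` (Thm. 12.5 (3)).  Seat g15 proved the FINE-SELMER shadow of the last two on the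
reducible non-CM rows from general facts — `char_Λ(𝐇¹_Γ/Λ𝐲) ⊆ char_Λ X₀(W/ℚ_∞)` for Kato's genuine zeta class `𝐲`, modulo
{`exists_member_eulerSystem_expStar_values` (Z0), `thm13_4_…` (Kato 13.4), `serre_adicImage_…` (Serre), `Lim2017.thm35_…`,
`ferreroWashington1979_…`} (`ReducibleZetaDivisibility.exists_zetaLift_charIdeal_le_fineSelmerDual`) — but `X₀` is not
Kato's `𝐇²`, and the two differ by exactly the (14.9.1)-limit comparison (memo FINDING-19196-rkm-g18, brick (c1)).  Since
2026-08-28 that comparison is a NAMED FACT of the tree in `IwasawaH2Data` currency: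
`Kato2004.exists_iwasawaH2Data_fineSelmerDual_embedding` (seat bsd-cm-prr-ty1) — for `p` odd, `κ` cyclotomic and
`W(ℚ_{p,∞})[p^∞]` finite, a package `J : IwasawaH2Data W p κ γ I` (Kato's `𝐇²_Γ(T_pW)`: (12.2.1), 12.4 (1), (14.14.1) pinned to
`H¹(ℤ[1/p],T_pW)` and `proj₀`) WITH an injection `X₀(W/ℚ_∞) ↪ J.H2` of finite cokernel.  Its finiteness hypothesis is
discharged on every row with `W(ℚ_p)[p] = 0` by `TowerTorsionVanishing` (this seat, p657752).  Composing:

* `charIdeal_eq_of_embedding`, `lengthAt_augIdealP_eq_zero_of_embedding`, `muInvariant_eq_zero_of_embedding` — algebra: an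
  injection with finite cokernel from a module with `ℓ_(p) = 0` transports `char` and kills `μ`.
* **`exists_iwasawaH2Data_zetaLift_charIdeal_le`** — on a reducible non-CM row (`W` globally minimal, `p ≠ 2`, `¬ W.HasCM`,
  `W[p]` reducible, `W(ℚ)` and `Ш(W)[p^∞]` finite, `L(W,1) ≠ 0`, `f` the newform, `W(ℚ_{p,∞})[p^∞]` finite), for the cyclotomic
  `(κ, γ)` and EVERY pin `I`: there are `J : IwasawaH2Data W p κ γ I`, an embedding `X₀ ↪ J.H2` with finite cokernel, and Kato's
  zeta class `𝐲 ∈ 𝐇¹_Γ(T_pW)` (`𝐲 ≠ 0`, `IsEulerSystemClass`) with **`char_Λ(𝐇¹_Γ/Λ𝐲) ⊆ char_Λ(J.H2)`** and **`μ(J.H2) = 0`** —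
  modulo the SIX atomic facts {H2X, Z0, 13.4, Serre, Lim 3.5, FW} and nothing else;
* `…_of_noPTorsionPadic` (`W(ℚ_p)[p] = 0` displayed), `…_of_addv_of_eleven_le` (every additive `p ≥ 11`: no local hypothesis),
  `…_of_addv` (`p ≥ 5` off Kodaira II/III).

WHAT THIS IS / IS NOT.  It is Kato Thm. 12.5 (4)-shape INTEGRAL divisibility `char 𝐇² ∣ char(𝐇¹/Λ𝐲)` for the (14.14.1)-pinned
`𝐇²` on rows where Kato's own text gives only the `⊗ℚ` statement 12.5 (3) (no (12.5.2) big image) — the integrality being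
Wuthrich's observation (μ = 0 under a `p`-isogeny), here from FW + Lim; and it realises the `H2`-block of 27962 from atoms by ONE
`J`.  It is NOT crux M: the class is the `(c,d)`-family class `𝐲` (not the normalised `z_γ`, so the multiplier `λ` of Lemma
13.10 (1) is not divided out), the level-`0` COUNT (c2′) `#(𝐇²/X𝐇²)` ((14.14.2) + (14.9.3)) and the zeta-line index (b′) are not
touched, and abstract `∃ J`-packages do not compose with the held `∃`-package (memo FINDING-19196-rkm-g26 §2).

References: K. Kato, Astérisque 295 (2004), §12.2 (12.2.1)–(12.2.3) (p. 220), Thm. 12.4 (1) (p. 221), Thm. 12.5 (3)(4) with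
(12.5.1)–(12.5.2) (p. 222), Thm. 13.4 (p. 226), (14.9.1) (p. 239), §14.14 (14.14.1) (p. 243) [Kato2004Asterisque]; C. Wuthrich,
Doc. Math. 19 (2014) Lemma 14 (p. 396) [Wuthrich2014]; L. Washington, GTM 83 §13.2 [Washington1997].
-/

-- the summit and its single problem are both named `BirchSwinnertonDyer` (registry layout D-0017)
set_option linter.dupNamespace false
set_option autoImplicit false

noncomputable section

open scoped Classical NumberField
open Function Field NumberField IsDedekindDomain CongruenceSubgroup
open Literature.NumberTheory.EllipticCurves Literature.NumberTheory.EllipticCurves.GreenbergSelmer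
open Literature.NumberTheory.GaloisRepresentations
open Literature.NumberTheory.EllipticCurves.ModularForms
open Literature.NumberTheory.EllipticCurves.Kato2004 Literature.NumberTheory.EllipticCurves.Kato2004.EulerSystemValues
open Literature.NumberTheory.EllipticCurves.IwasawaAlgebra
open Literature.NumberTheory.EllipticCurves.Rank1Residual
open Summit.BirchSwinnertonDyer.Rank1Residual

namespace Summit.BirchSwinnertonDyer.BirchSwinnertonDyer.Theorems.ReducibleH2Divisibility

/-! ## §1 Algebra: an embedding with finite cokernel from a module with `ℓ_(p) = 0` -/

section Algebra

variable {p : ℕ} [Fact p.Prime] {X M : Type} [AddCommGroup X] [Module (IwasawaAlgebra p) X]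
  [AddCommGroup M] [Module (IwasawaAlgebra p) M]

/-- An injective `Λ`-linear map with finite cokernel identifies characteristic ideals (it is a pseudo-isomorphism, so the local
lengths at every height-one prime agree). [cite: Washington1997, §13.2] -/
theorem charIdeal_eq_of_embedding (e : X →ₗ[IwasawaAlgebra p] M) (he : Injective e)
    (hfin : Finite (M ⧸ LinearMap.range e)) :
    Module.charIdeal (IwasawaAlgebra p) M = Module.charIdeal (IwasawaAlgebra p) X := by
  unfold Module.charIdeal
  exact finprod_mem_congr rfl fun 𝔮 h𝔮 => by
    rw [lengthAt_eq_of_injective_of_finite_quotient e he hfin 𝔮 (le_of_eq h𝔮)]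

/-- If `X` has vanishing local length at `(p)` (e.g. `X/pX` finite) and embeds in `M` with finite cokernel, then `ℓ_(p)(M) = 0`.
[cite: Washington1997, §13.2] -/
theorem lengthAt_augIdealP_eq_zero_of_embedding (e : X →ₗ[IwasawaAlgebra p] M) (he : Injective e)
    (hfin : Finite (M ⧸ LinearMap.range e)) (𝔭 : PrimeSpectrum (IwasawaAlgebra p)) (h𝔭 : 𝔭.asIdeal = augIdealP p)
    (hX : Module.lengthAt (IwasawaAlgebra p) X 𝔭 = 0) :
    Module.lengthAt (IwasawaAlgebra p) M 𝔭 = 0 := by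
  have h1 : 𝔭.asIdeal.height ≤ 1 := by rw [h𝔭]; exact le_of_eq (height_augIdealP_holds p)
  rw [← lengthAt_eq_of_injective_of_finite_quotient e he hfin 𝔭 h1, hX]

/-- If `X` has vanishing local length at `(p)` and embeds in `M` with finite cokernel, then `μ(M) = 0`.
[cite: Washington1997, §13.2] -/
theorem muInvariant_eq_zero_of_embedding (e : X →ₗ[IwasawaAlgebra p] M) (he : Injective e)
    (hfin : Finite (M ⧸ LinearMap.range e))
    (hX : ∀ 𝔭 : PrimeSpectrum (IwasawaAlgebra p), 𝔭.asIdeal = augIdealP p → Module.lengthAt (IwasawaAlgebra p) X 𝔭 = 0) :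
    muInvariant p M = 0 := by
  haveI : (augIdealP p).IsPrime := isPrime_augIdealP_holds p
  let 𝔭 : PrimeSpectrum (IwasawaAlgebra p) := ⟨augIdealP p, inferInstance⟩
  rw [muInvariant_eq_toNat_lengthAt p M 𝔭 rfl, lengthAt_augIdealP_eq_zero_of_embedding e he hfin 𝔭 rfl (hX 𝔭 rfl)]
  rfl

end Algebra

/-! ## §2 Kato's (14.14.1)-pinned `𝐇²` on the reducible non-CM rank-`0` rows: embedding, `μ = 0`, divisibility -/

section Reducible

variable (W : WeierstrassCurve ℚ) [W.IsElliptic] (p : ℕ) [Fact p.Prime]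
  [ContinuousSMul ℤ_[p] (W.tateModule p)] [Module.Free ℤ_[p] (W.tateModule p)] [Module.Finite ℤ_[p] (W.tateModule p)]

/-- **Kato 12.5 (3)–(4) / Wuthrich L.14 for the (14.14.1)-pinned `𝐇²` on a REDUCIBLE non-CM rank-`0` row, from atomic facts.**
For `W/ℚ` non-CM with `W[p]` reducible (`p ≠ 2`), `W(ℚ)` and `Ш(W)[p^∞]` finite, `L(W,1) ≠ 0`, `f` its newform, the cyclotomic
`κ` with generator `γ`, the place `v ∣ p`, `W(ℚ_{p,∞})[p^∞]` finite, and EVERY pin `I : IwasawaH1Data W p κ γ`: there are a descent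
package `J : IwasawaH2Data W p κ γ I` (Kato's `𝐇²_Γ(T_pW)` with (14.14.1) pinned), an injective `Λ`-linear `X₀(W/ℚ_∞) ↪ J.H2`
with finite cokernel, and Kato's zeta class `𝐲 ∈ 𝐇¹_Γ(T_pW)` (`𝐲 ≠ 0`, a genuine Euler-system class) with
`char_Λ(𝐇¹_Γ(T_pW)/Λ𝐲) ⊆ char_Λ(J.H2)` — i.e. `char 𝐇² ∣ char(𝐇¹/Λ𝐲)`, INTEGRALLY — and `μ(J.H2) = 0`.  Modulo the six named
facts in the binders and nothing else. [cite: Kato2004Asterisque, Thm. 12.5 (3)(4) (p. 222), Thm. 13.4 (p. 226), (14.9.1) (p. 239), (14.14.1) (p. 243)]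
[cite: Wuthrich2014, Lemma 14 (p. 396)] -/
theorem exists_iwasawaH2Data_zetaLift_charIdeal_le
    (hX : exists_iwasawaH2Data_fineSelmerDual_embedding)
    (hZ0 : exists_member_eulerSystem_expStar_values)
    (h134 : thm13_4_lengthAt_fineSelmerDual_le_of_isEulerSystemClass)
    (hSerre : serre_adicImage_contains_congruenceSubgroup)
    (hLim : Lim2017.thm35_fineSelmerDual_moduleFinite_of_classicalMuVanishes_of_le_divisionField)
    (hFW : Literature.NumberTheory.IwasawaTheory.ferreroWashington1979_classicalMuVanishes)
    [Finite W.toAffine.Point] [Finite (AddCommGroup.primaryComponent W.sha p)]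
    {κ : ZpExtension ℚ p} {γ : absoluteGaloisGroup ℚ} (hp : p ≠ 2) (hκ : κ.IsCyclotomic) (hγ : κ.IsTopGenerator γ)
    (hCM : ¬ W.HasCM) (hred : ¬ W.HasIrreducibleModPGaloisRep p)
    (v : HeightOneSpectrum (𝓞 ℚ)) (hv : ((Rat.HeightOneSpectrum.primesEquiv v : Nat.Primes) : ℕ) = p)
    (hfin : Finite (FixedPoints.addSubgroup ↥(κ.kerSubgroup ⊓ decomp v) (W.geomPrimaryTorsion p)))
    (I : IwasawaH1Data W p κ γ) {N : ℕ} [NeZero N] (f : CuspForm (Gamma0 N) 2) (hf : IsNewformOf W f)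
    (hL1 : W.entireLFunction 1 ≠ 0) (ι : (m : ℕ) → (CyclotomicField m ℚ →+* ℂ)) :
    ∃ (J : IwasawaH2Data W p κ γ I) (e : (W.fineSelmerDualData κ hγ).X →ₗ[IwasawaAlgebra p] J.H2) (y : I.H),
      Injective e ∧ Finite (J.H2 ⧸ LinearMap.range e) ∧ y ≠ 0 ∧ IsEulerSystemClass W p κ γ I y ∧
      Module.charIdeal (IwasawaAlgebra p) (I.H ⧸ Submodule.span (IwasawaAlgebra p) {y}) ≤
        Module.charIdeal (IwasawaAlgebra p) J.H2 ∧
      muInvariant p J.H2 = 0 := by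
  -- Kato's `𝐇² ⊇ X₀` package (the named fact, hypothesis `hfin`)
  obtain ⟨J, e, he, hfin'⟩ := hX W p κ γ hγ v hp hκ hv hfin I
  -- the fine-Selmer divisibility for Kato's zeta class on the reducible row (seat g15), on THE constructed datum
  obtain ⟨y, hy0, hES, hchar⟩ := ReducibleZetaDivisibility.exists_zetaLift_charIdeal_le_fineSelmerDual hZ0 h134 hSerre hLim
    hFW W p hp hκ hγ hCM hred I (W.fineSelmerDualData κ hγ) f hf hL1 ι
  -- statement (A) on the reducible row ⇒ `X₀/pX₀` finite ⇒ `ℓ_(p)(X₀) = 0`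
  have hA := ReducibleFineSelmerMuZero.fineSelmerDual_moduleFinite_of_not_irreducible hLim hFW W p hp hred κ hκ
  have hpt : Set.Finite {t : W.fineSelmerInfty κ | p • t = 0} :=
    (IwasawaModuleFinitePadicInt.exists_fineSelmerDualData_moduleFinite_iff_finite_pTorsion W κ hγ).mp hA
  haveI : Module.Finite (IwasawaAlgebra p) (W.fineSelmerDualData κ hγ).X :=
    (W.fineSelmerDualData κ hγ).module_finite_of_finite_pTorsion hγ hpt
  haveI : Finite ((W.fineSelmerDualData κ hγ).X ⧸
      (augIdealP p • (⊤ : Submodule (IwasawaAlgebra p) (W.fineSelmerDualData κ hγ).X))) :=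
    (W.fineSelmerDualData κ hγ).finite_quotient_augIdealP_of_finite_pTorsion hpt
  have hX0 : ∀ 𝔭 : PrimeSpectrum (IwasawaAlgebra p), 𝔭.asIdeal = augIdealP p →
      Module.lengthAt (IwasawaAlgebra p) (W.fineSelmerDualData κ hγ).X 𝔭 = 0 :=
    fun 𝔭 h𝔭 => Rank1Residual.KatoMuSkeleton.lengthAt_eq_zero_of_finite_quotient_p (M := (W.fineSelmerDualData κ hγ).X) 𝔭 h𝔭
  refine ⟨J, e, y, he, hfin', hy0, hES, ?_, muInvariant_eq_zero_of_embedding e he hfin' hX0⟩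
  rw [charIdeal_eq_of_embedding e he hfin']
  exact hchar

/-- **The same with the local hypothesis `W(ℚ_p)[p] = 0` displayed** (then `W(ℚ_{p,∞})[p^∞] = 0`, `TowerTorsionVanishing`) —
valid at the wild prime `p = 3` on the rows with (c3*). [cite: Kato2004Asterisque, Thm. 12.5 (3)(4) (p. 222), (14.9.1) (p. 239), (14.14.1) (p. 243)]
[cite: Wuthrich2014, Lemma 14 (p. 396)] [cite: GreenbergLNM1716, §3 Lemma 3.1] -/
theorem exists_iwasawaH2Data_zetaLift_charIdeal_le_of_noPTorsionPadic
    (hX : exists_iwasawaH2Data_fineSelmerDual_embedding)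
    (hZ0 : exists_member_eulerSystem_expStar_values)
    (h134 : thm13_4_lengthAt_fineSelmerDual_le_of_isEulerSystemClass)
    (hSerre : serre_adicImage_contains_congruenceSubgroup)
    (hLim : Lim2017.thm35_fineSelmerDual_moduleFinite_of_classicalMuVanishes_of_le_divisionField)
    (hFW : Literature.NumberTheory.IwasawaTheory.ferreroWashington1979_classicalMuVanishes)
    [Finite W.toAffine.Point] [Finite (AddCommGroup.primaryComponent W.sha p)]
    {κ : ZpExtension ℚ p} {γ : absoluteGaloisGroup ℚ} (hp : p ≠ 2) (hκ : κ.IsCyclotomic) (hγ : κ.IsTopGenerator γ)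
    (hCM : ¬ W.HasCM) (hred : ¬ W.HasIrreducibleModPGaloisRep p)
    (v : HeightOneSpectrum (𝓞 ℚ)) (hv : ((Rat.HeightOneSpectrum.primesEquiv v : Nat.Primes) : ℕ) = p)
    (h4 : ∀ R : (W.baseChange ℚ_[p]).toAffine.Point, p • R = 0 → R = 0)
    (I : IwasawaH1Data W p κ γ) {N : ℕ} [NeZero N] (f : CuspForm (Gamma0 N) 2) (hf : IsNewformOf W f)
    (hL1 : W.entireLFunction 1 ≠ 0) (ι : (m : ℕ) → (CyclotomicField m ℚ →+* ℂ)) :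
    ∃ (J : IwasawaH2Data W p κ γ I) (e : (W.fineSelmerDualData κ hγ).X →ₗ[IwasawaAlgebra p] J.H2) (y : I.H),
      Injective e ∧ Finite (J.H2 ⧸ LinearMap.range e) ∧ y ≠ 0 ∧ IsEulerSystemClass W p κ γ I y ∧
      Module.charIdeal (IwasawaAlgebra p) (I.H ⧸ Submodule.span (IwasawaAlgebra p) {y}) ≤
        Module.charIdeal (IwasawaAlgebra p) J.H2 ∧
      muInvariant p J.H2 = 0 :=
  exists_iwasawaH2Data_zetaLift_charIdeal_le W p hX hZ0 h134 hSerre hLim hFW hp hκ hγ hCM hred v hv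
    (TowerTorsionVanishing.finite_fixedPoints_kerSubgroup_inf_decomp_of_noPTorsionPadic W p κ v hv h4) I f hf hL1 ι

/-- **On every ADDITIVE row at `p ≥ 11`** (no local hypothesis: `W(ℚ_p)[p] = 0` is a tree theorem there) — in particular on every
reducible non-CM (t′) row of crux M at `p ≥ 11`. [cite: Kato2004Asterisque, Thm. 12.5 (3)(4) (p. 222), (14.9.1) (p. 239), (14.14.1) (p. 243)]
[cite: Wuthrich2014, Lemma 14 (p. 396)] [cite: Mazur1977, Ch. III §5, Step 1 (p. 158)] -/
theorem exists_iwasawaH2Data_zetaLift_charIdeal_le_of_addv_of_eleven_le [W.IsGloballyMinimal]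
    (hX : exists_iwasawaH2Data_fineSelmerDual_embedding)
    (hZ0 : exists_member_eulerSystem_expStar_values)
    (h134 : thm13_4_lengthAt_fineSelmerDual_le_of_isEulerSystemClass)
    (hSerre : serre_adicImage_contains_congruenceSubgroup)
    (hLim : Lim2017.thm35_fineSelmerDual_moduleFinite_of_classicalMuVanishes_of_le_divisionField)
    (hFW : Literature.NumberTheory.IwasawaTheory.ferreroWashington1979_classicalMuVanishes)
    [Finite W.toAffine.Point] [Finite (AddCommGroup.primaryComponent W.sha p)]
    {κ : ZpExtension ℚ p} {γ : absoluteGaloisGroup ℚ} (h11 : 11 ≤ p) (hadd : Addv W p)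
    (hκ : κ.IsCyclotomic) (hγ : κ.IsTopGenerator γ) (hCM : ¬ W.HasCM) (hred : ¬ W.HasIrreducibleModPGaloisRep p)
    (v : HeightOneSpectrum (𝓞 ℚ)) (hv : ((Rat.HeightOneSpectrum.primesEquiv v : Nat.Primes) : ℕ) = p)
    (I : IwasawaH1Data W p κ γ) {N : ℕ} [NeZero N] (f : CuspForm (Gamma0 N) 2) (hf : IsNewformOf W f)
    (hL1 : W.entireLFunction 1 ≠ 0) (ι : (m : ℕ) → (CyclotomicField m ℚ →+* ℂ)) :
    ∃ (J : IwasawaH2Data W p κ γ I) (e : (W.fineSelmerDualData κ hγ).X →ₗ[IwasawaAlgebra p] J.H2) (y : I.H),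
      Injective e ∧ Finite (J.H2 ⧸ LinearMap.range e) ∧ y ≠ 0 ∧ IsEulerSystemClass W p κ γ I y ∧
      Module.charIdeal (IwasawaAlgebra p) (I.H ⧸ Submodule.span (IwasawaAlgebra p) {y}) ≤
        Module.charIdeal (IwasawaAlgebra p) J.H2 ∧
      muInvariant p J.H2 = 0 :=
  exists_iwasawaH2Data_zetaLift_charIdeal_le_of_noPTorsionPadic W p hX hZ0 h134 hSerre hLim hFW (by omega) hκ hγ hCM hred
    v hv (fun _ hR => Additive.eq_zero_of_prime_nsmul_eq_zero_of_addv_of_eleven_le W p h11 hadd hR) I f hf hL1 ι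

/-- **On an additive row at `p ≥ 5` off Kodaira II/III** (`p = 5 ⟹ v₅(c₄) ≠ 1`, `p = 7 ⟹ v₇(c₆) ≠ 1`).
[cite: Kato2004Asterisque, Thm. 12.5 (3)(4) (p. 222), (14.9.1) (p. 239), (14.14.1) (p. 243)] [cite: Wuthrich2014, Lemma 14 (p. 396)]
[cite: Mazur1977, Ch. III §5, Step 1 (p. 158)] -/
theorem exists_iwasawaH2Data_zetaLift_charIdeal_le_of_addv [W.IsGloballyMinimal]
    (hX : exists_iwasawaH2Data_fineSelmerDual_embedding)
    (hZ0 : exists_member_eulerSystem_expStar_values)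
    (h134 : thm13_4_lengthAt_fineSelmerDual_le_of_isEulerSystemClass)
    (hSerre : serre_adicImage_contains_congruenceSubgroup)
    (hLim : Lim2017.thm35_fineSelmerDual_moduleFinite_of_classicalMuVanishes_of_le_divisionField)
    (hFW : Literature.NumberTheory.IwasawaTheory.ferreroWashington1979_classicalMuVanishes)
    [Finite W.toAffine.Point] [Finite (AddCommGroup.primaryComponent W.sha p)]
    {κ : ZpExtension ℚ p} {γ : absoluteGaloisGroup ℚ} (hp5 : 5 ≤ p) (hadd : Addv W p)
    (h5 : p = 5 → padicValRat p W.c₄ ≠ 1) (h7 : p = 7 → padicValRat p W.c₆ ≠ 1)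
    (hκ : κ.IsCyclotomic) (hγ : κ.IsTopGenerator γ) (hCM : ¬ W.HasCM) (hred : ¬ W.HasIrreducibleModPGaloisRep p)
    (v : HeightOneSpectrum (𝓞 ℚ)) (hv : ((Rat.HeightOneSpectrum.primesEquiv v : Nat.Primes) : ℕ) = p)
    (I : IwasawaH1Data W p κ γ) {N : ℕ} [NeZero N] (f : CuspForm (Gamma0 N) 2) (hf : IsNewformOf W f)
    (hL1 : W.entireLFunction 1 ≠ 0) (ι : (m : ℕ) → (CyclotomicField m ℚ →+* ℂ)) :
    ∃ (J : IwasawaH2Data W p κ γ I) (e : (W.fineSelmerDualData κ hγ).X →ₗ[IwasawaAlgebra p] J.H2) (y : I.H),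
      Injective e ∧ Finite (J.H2 ⧸ LinearMap.range e) ∧ y ≠ 0 ∧ IsEulerSystemClass W p κ γ I y ∧
      Module.charIdeal (IwasawaAlgebra p) (I.H ⧸ Submodule.span (IwasawaAlgebra p) {y}) ≤
        Module.charIdeal (IwasawaAlgebra p) J.H2 ∧
      muInvariant p J.H2 = 0 :=
  exists_iwasawaH2Data_zetaLift_charIdeal_le_of_noPTorsionPadic W p hX hZ0 h134 hSerre hLim hFW (by omega) hκ hγ hCM hred
    v hv (fun _ hR => Additive.eq_zero_of_prime_nsmul_eq_zero_of_addv W p hp5 hadd h5 h7 hR) I f hf hL1 ι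

end Reducible

end Summit.BirchSwinnertonDyer.BirchSwinnertonDyer.Theorems.ReducibleH2Divisibility

end
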